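/-
Copyright (c) 2026. All rights reserved.
Released under Apache 2.0 license as described in the file LICENSE.
Authors: abc-iut cell, seat abc-iut-f-069 (gen 3; row «P13-INDEX-OFEMBEDDING», abc-iut-L4-lead RULING #8e).
-/
import Literature.AnabelianGeometry.AbsoluteAnabelian.AbsTopII.DPSCIndexDataOfEmbedding
import Literature.AnabelianGeometry.AbsoluteAnabelian.AbsTopII.InertiaDecompositionBranch

/-!
# [AbsTopII] Prop 1.3 (iii) at the CONSTRUCTED DPSC data: the cusp input and "`I_v ↠ I`" DISCHARGED

S. Mochizuki, *Topics in Absolute Anabelian Geometry II* [AbsTopII] (bib `MochizukiAbsTopII2013`; kurims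
manuscript `paper:url-585b8d0ad0d9`), §1 Def 1.2 (ii) p. 10, Prop 1.3 (iii) p. 11, proof p. 13:
"Since `Π_v` is slim … and commensurably terminal in `Π_𝔾` …, `I_v ∩ Π_𝔾 = {1}`, so we obtain a natural
injection `I_v ↪ I`. The fact that this injection is, in fact, surjective is immediate from the definitions
when `X` is smooth over `k` and follows from the computation of '`I_v`' performed in the proof of assertion
(ii) when `X` is singular. … Now suppose that `e` is a cusp that abuts to `v`. Then [for appropriate choices
of conjugates] it follows immediately from the definitions that we have inclusions `I_e, I_v ⊆ D_e ∩ Π_I`,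
and that `I_e` commutes with `I_v`."  [CbTpII] (Hoshi–Mochizuki) Def 4.4: profinite Dehn multi-twists.

PROOF-ONLY companion of `AbsTopII/DPSCIndexDataOfEmbedding.lean` (abc-iut-f-069, p440384) over
abc-iut-w5-d226's `DPSCData.ofEmbedding` / `ofOuterAction`, abc-iut-L4-t6's closers (p427149) and
abc-iut-f-069's `InertiaDecompositionBranch.lean` (p439117).  PROVED here:

* `DPSCIndexData.prop_1_3_iii'_ofEmbedding` — **[AbsTopII] Prop 1.3 (iii) (rest) AS TYPED (F-0299,
  `Prop_1_3_iii'`) at every embedded datum** from: [CombGC] Prop 1.2 (ii) for `G` (L3's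
  `VerticialEdgeLikeCommensurablyTerminal`, F-0438, BY NAME), slimness of `G`'s verticial subgroups ([CombGC]
  Rmk 1.1.3, named), "`I_v ↠ I`" and "`I_v ≅ Ẑ^Σ`" — the cusp input of the sub-DAG (row I-cuspconj) being
  DISCHARGED by `cuspconj_ofEmbedding` (L3's `PSCDatum.cuspGp_le`);
* `DPSCData.hsurj_ofOuterAction_of_fixingLifts` — **row I-surj ("`I_v ↠ I`", i.e. `I_v · Π_𝔾 = Π_I`)
  DISCHARGED at the DPSC-extension `Π_𝒢 ⋊^out_θ J` of construction data from a condition on the construction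
  data alone**: every `i ∈ I` admits, for each vertex `v`, a (bi-continuous) lift of the outer class `θ(i)`
  fixing `Π_v` pointwise — i.e. `ρ_I` acts through profinite Dehn multi-twists ([CbTpII] Def 4.4: graphic,
  trivial on the underlying semi-graph, inducing the trivial OUTER automorphism of each `Π_v`; a lift fixing
  `Π_v` pointwise is then obtained by an inner correction).  `hsurj_ofOuterAction_of_trivial`: in
  particular when `θ|_I = 1` ("immediate from the definitions when `X` is smooth over `k`");
* `DPSCData.prop13iii_ofOuterAction_of_fixingLifts` — t4's `Prop13iii` (F-0275) at `Π_𝒢 ⋊^out_θ J` from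
  {F-0438, Rmk 1.1.3 slimness, Dehn-type lifts} ONLY (w5-d226's `prop13iii_ofOuterAction` minus `hsurj`);
  `DPSCIndexData.prop_1_3_iii'_ofOuterAction_of_fixingLifts` — (iii)′ (F-0299) there from the same +
  "`I_v ≅ Ẑ^Σ`".
HONEST FRAMING: classical group theory over the typed interfaces; the inputs that remain are NAMED ([CombGC]
Prop 1.2 (ii) = F-0438, Rmk 1.1.3, the Dehn-type condition on `ρ_I`, "`I_v ≅ Ẑ^Σ`"); typed ≠ proved;
nothing here bears on [IUTchIII] Cor 3.12 or takes a side on any author.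
-/

noncomputable section

open scoped Pointwise

namespace Literature.AnabelianGeometry.AbsoluteAnabelian

open Literature.AlgebraicGeometry.Frobenioids (IsSlimGroup)
open Literature.AnabelianGeometry.EtaleTheta (contMulAut mem_contMulAut TopOut innerContAut innerAut)
open Literature.AnabelianGeometry.SemiGraphs
open Literature.AnabelianGeometry.Anabelioids (IsSigmaInteger)
open Topology

universe u

/-! ## §1. "`I_v ↠ I`" at `Π_𝒢 ⋊^out_θ J` from Dehn-type lifts of `ρ_I` -/

namespace DPSCData

section OuterAction

variable {P : Type u} [Group P] [TopologicalSpace P] [IsTopologicalGroup P] [CompactSpace P]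
  [TotallyDisconnectedSpace P] (G : PSCDatum P) (hG : IsTopologicallyFinitelyGenerated P)
  {J : Type u} [Group J] [TopologicalSpace J] [IsTopologicalGroup J] [CompactSpace J]
  [TotallyDisconnectedSpace J] (θ : J →ₜ* outProfinite hG) (I : Subgroup J) [I.Normal]

/-- **Row I-surj ("`I_v ↠ I`") DISCHARGED at the DPSC-extension of construction data from Dehn-type lifts
of `ρ_I`.**  If every `i ∈ I` has, for each vertex `v` of `𝒢`, a bi-continuous lift `φ` of the outer class
`θ(i) ∈ Out(Π_𝒢)` fixing `Π_v` pointwise, then `I_v · Π_𝔾 = Π_I` for the REAL `I_v := Z_{Π_I}(Π_v)` of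
`Π_𝒢 ⋊^out_θ J`: for `y ∈ Π_I` over `i`, the `Aut`-component of `y` differs from `φ` by an inner
automorphism `conj p` (`mk_autComponent`), and `h := inl(φ p)⁻¹ · y` centralises `inl(Π_v)` and lies over
`i`, so `y = inl(φ p) · h ∈ Π_𝔾 · I_v`.  (Proof of (iii) p. 13: "this injection is, in fact, surjective …
immediate from the definitions when `X` is smooth over `k` and … from the computation of '`I_v`' … when `X`
is singular" — the computation being that inertia acts on each `Π_v` by an inner automorphism.)
[cite: MochizukiAbsTopII2013, Prop 1.3 (iii) proof p.13] -/
theorem hsurj_ofOuterAction_of_fixingLifts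
    (hDehn : ∀ (v : G.graph.V) (i : J), i ∈ I → ∃ φ : P ≃ₜ* P,
      TopOut.mk P ⟨φ.toMulEquiv, (mem_contMulAut P).mpr ⟨φ.continuous, φ.symm.continuous⟩⟩ =
        outerActionOfContinuous hG θ i ∧ ∀ x ∈ G.vertGp v, φ x = x)
    (v : (ofOuterAction G hG θ I).Vert) :
    (ofOuterAction G hG θ I).Iv v ⊔ (ofOuterAction G hG θ I).PiG = (ofOuterAction G hG θ I).PiI := by
  apply le_antisymm (sup_le inf_le_right (ofOuterAction G hG θ I).PiG_le_PiI)
  intro y₀ hy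
  -- work in the carrier of `Π_𝒢 ⋊^out_θ J` (= `Π_H` of the constructed datum, by `rfl`)
  obtain ⟨y, rfl⟩ : ∃ y : outerSemidirectProfinite hG θ, y = y₀ := ⟨y₀, rfl⟩
  have hyI : sndProfinite hG θ y ∈ I := hy
  obtain ⟨φ, hφ, hfix⟩ := hDehn v.down _ hyI
  -- the `Aut`-component of `y` and `φ` have the same outer class, hence differ by an inner automorphism
  set c : contMulAut P := ⟨φ.toMulEquiv, (mem_contMulAut P).mpr ⟨φ.continuous, φ.symm.continuous⟩⟩ with hc
  have hclass : TopOut.mk P (autComponent hG θ y) = TopOut.mk P c := by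
    rw [mk_autComponent]
    exact hφ.symm
  have hmem : c⁻¹ * autComponent hG θ y ∈ innerContAut P := by
    rw [← QuotientGroup.eq]
    exact hclass.symm
  obtain ⟨p, hp⟩ : ∃ p : P, MulAut.conj p = ((c⁻¹ * autComponent hG θ y : contMulAut P) : MulAut P) :=
    Subgroup.mem_subgroupOf.mp hmem
  have hmul : (c : MulAut P) * MulAut.conj p = (autComponent hG θ y : MulAut P) := by
    rw [hp, Subgroup.coe_mul, InvMemClass.coe_inv, mul_inv_cancel_left]
  have hconj : ∀ x, conjAutOf hG θ y x = φ p * φ x * (φ p)⁻¹ := by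
    intro x
    have hx := congrArg (fun ψ : MulAut P => ψ x) hmul
    simp only [MulAut.mul_apply, MulAut.conj_apply] at hx
    rw [conjAutOf_apply, ← hx]
    change φ (p * x * p⁻¹) = _
    rw [map_mul, map_mul, map_inv]
  -- the corrected element `h := inl(φ p)⁻¹ · y`
  set q : P := φ p with hq
  set h : outerSemidirectProfinite hG θ := (inlProfinite hG θ q)⁻¹ * y with hh
  have hcomm : ∀ x ∈ G.vertGp v.down, h * inlProfinite hG θ x * h⁻¹ = inlProfinite hG θ x := by
    intro x hx
    have e1 : y * inlProfinite hG θ x * y⁻¹ = inlProfinite hG θ (q * φ x * q⁻¹) := by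
      rw [← hconj x, inlProfinite_conjAutOf]
    have e2 : h * inlProfinite hG θ x * h⁻¹ =
        (inlProfinite hG θ q)⁻¹ * (y * inlProfinite hG θ x * y⁻¹) * inlProfinite hG θ q := by
      rw [hh, mul_inv_rev, inv_inv]
      group
    rw [e2, e1, ← map_inv, ← map_mul, ← map_mul, hfix x hx]
    congr 1
    group
  -- `h ∈ I_v`: it centralises `Π_v = inl(Π_{𝒢,v})` and lies in `Π_I`
  have hhI : h ∈ (ofOuterAction G hG θ I).Iv v := by
    refine Subgroup.mem_inf.mpr ⟨?_, ?_⟩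
    · refine Subgroup.mem_centralizer_iff.mpr (fun m hm => ?_)
      obtain ⟨x, hx, rfl⟩ := Subgroup.mem_map.mp hm
      show inlProfinite hG θ x * h = h * inlProfinite hG θ x
      have e3 := hcomm x hx
      calc inlProfinite hG θ x * h = h * inlProfinite hG θ x * h⁻¹ * h := by rw [e3]
        _ = h * inlProfinite hG θ x := by rw [inv_mul_cancel_right]
    · show sndProfinite hG θ h ∈ I
      rw [hh, map_mul, map_inv, sndProfinite_inlProfinite, inv_one, one_mul]
      exact hyI
  -- `y = inl(q) · h ∈ Π_𝔾 · I_v`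
  have hy' : y = inlProfinite hG θ q * h := by rw [hh, mul_inv_cancel_left]
  rw [hy', sup_comm]
  exact Subgroup.mul_mem_sup ⟨q, rfl⟩ hhI

/-- **"Immediate from the definitions when `X` is smooth over `k`"** (proof of (iii) p. 13): if the inertia
subgroup `I ⊆ J` acts TRIVIALLY through `θ` (trivial outer action on `Π_𝒢`), then `I_v · Π_𝔾 = Π_I` for
every vertex (the identity is a lift fixing everything). [cite: MochizukiAbsTopII2013, Prop 1.3 (iii) proof p.13] -/
theorem hsurj_ofOuterAction_of_trivial (hI : ∀ i ∈ I, θ i = 1) (v : (ofOuterAction G hG θ I).Vert) :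
    (ofOuterAction G hG θ I).Iv v ⊔ (ofOuterAction G hG θ I).PiG = (ofOuterAction G hG θ I).PiI := by
  refine hsurj_ofOuterAction_of_fixingLifts G hG θ I (fun w i hi => ⟨ContinuousMulEquiv.refl P, ?_,
    fun x _ => rfl⟩) v
  have h1 : outerActionOfContinuous hG θ i = 1 := by
    change (outEquiv hG).symm (θ i) = 1
    rw [hI i hi, map_one]
  have h2 : (⟨(ContinuousMulEquiv.refl P).toMulEquiv, (mem_contMulAut P).mpr
      ⟨(ContinuousMulEquiv.refl P).continuous, (ContinuousMulEquiv.refl P).symm.continuous⟩⟩ :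
        contMulAut P) = 1 := Subtype.ext rfl
  rw [h1, h2, map_one]

/-- **[AbsTopII] Prop 1.3 (iii), first clauses, AS TYPED (F-0275, abc-iut-L4-t4's `DPSCData.Prop13iii`) for
`Π_𝒢 ⋊^out_θ J` from [CombGC] Prop 1.2 (ii) for `G` (F-0438), slimness of `G`'s verticial subgroups
(Rmk 1.1.3) and Dehn-type lifts of `ρ_I` ONLY** — abc-iut-w5-d226's `prop13iii_ofOuterAction` with its
"`I_v ↠ I`" hypothesis DISCHARGED. [cite: MochizukiAbsTopII2013, Prop 1.3 (iii) p.11]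
[cite: MochizukiCombGC2007, Prop 1.2 p.8] -/
theorem prop13iii_ofOuterAction_of_fixingLifts (hZ : Subgroup.center P = ⊥)
    (hCT : G.VerticialEdgeLikeCommensurablyTerminal) (hslimv : ∀ w, IsSlimGroup ↥(G.vertGp w))
    (hDehn : ∀ (v : G.graph.V) (i : J), i ∈ I → ∃ φ : P ≃ₜ* P,
      TopOut.mk P ⟨φ.toMulEquiv, (mem_contMulAut P).mpr ⟨φ.continuous, φ.symm.continuous⟩⟩ =
        outerActionOfContinuous hG θ i ∧ ∀ x ∈ G.vertGp v, φ x = x) :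
    (ofOuterAction G hG θ I).Prop13iii :=
  prop13iii_ofOuterAction G hG hZ θ I hCT hslimv (hsurj_ofOuterAction_of_fixingLifts G hG θ I hDehn)

end OuterAction

end DPSCData

/-! ## §2. Prop 1.3 (iii)′ at the constructed `DPSCIndexData` -/

namespace AbsTopII.DPSCIndexData

section Embedding

variable {P : Type u} [Group P] [TopologicalSpace P] [CompactSpace P]
  (G : PSCDatum P) (E : ProfiniteGrp.{u}) (ι : P →* E) (hιc : Continuous ι)
  (hιi : Function.Injective ι) (hιr : IsClosed (ι.range : Set E)) (hιn : ι.range.Normal)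
  (PiI : Subgroup E) (hIn : PiI.Normal) (hle : ι.range ≤ PiI)
  (σ : G.graph.N → ℕ) (hσ : ∀ e, IsSigmaInteger G.Sigma (σ e))

include hιc hιi

/-- **[AbsTopII] Prop 1.3 (iii) (rest) AS TYPED (F-0299, `Prop_1_3_iii'`) at every embedded datum**, from:
[CombGC] Prop 1.2 (ii) for `G` (L3's `VerticialEdgeLikeCommensurablyTerminal`, F-0438); slimness of `G`'s
verticial subgroups ([CombGC] Rmk 1.1.3); "`I_v ↠ I`" (`I_v · Π_𝔾 = Π_I`); "`I_v ≅ Ẑ^Σ`" — and NOTHING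
about the cusps: the printed "[for appropriate choices of conjugates] `I_e, I_v ⊆ D_e ∩ Π_I` and `I_e`
commutes with `I_v`" is supplied by L3's cusp branch datum (`cuspconj_ofEmbedding`).
[cite: MochizukiAbsTopII2013, Prop 1.3 (iii) p.11] [cite: MochizukiCombGC2007, Prop 1.2 p.8] -/
theorem prop_1_3_iii'_ofEmbedding
    (hCT : G.VerticialEdgeLikeCommensurablyTerminal) (hslimv : ∀ w, IsSlimGroup ↥(G.vertGp w))
    (hsurj : ∀ v, (DPSCData.ofEmbedding G E ι hιr hιn PiI hIn hle).Iv v ⊔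
      (DPSCData.ofEmbedding G E ι hιr hιn PiI hIn hle).PiG = (DPSCData.ofEmbedding G E ι hιr hιn PiI hIn hle).PiI)
    (hcyc : ∀ v, IsFreeProSigmaCyclic G.Sigma ↥((DPSCData.ofEmbedding G E ι hιr hιn PiI hIn hle).Iv v)) :
    Literature.AnabelianGeometry.AbsoluteAnabelian.AbsTopII.DPSCIndexData.Prop_1_3_iii'
      (ofEmbedding G E ι hιr hιn PiI hIn hle σ hσ) := by
  obtain ⟨e, he⟩ := DPSCData.exists_rangeEquiv G E ι hιr hιn PiI hIn hle hιc hιi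
  -- the PSC datum transported along `Π_𝒢 ≃ₜ* Π_𝔾` presents the embedded datum (abc-iut-w5-d226)
  have hslim' : ∀ w, IsSlimGroup
      ↥((G.mapAlong e.toMulEquiv.toMonoidHom e.continuous G.Sigma subset_rfl G.sigma_nonempty
        (G.proSigma.of_continuousMulEquiv e)).vertGp w) := fun w => by
    rw [PSCDatum.mapAlong_vertGp]
    exact DPSCData.isSlimGroup_map_continuousMulEquiv e (hslimv w)
  refine (ofEmbedding G E ι hιr hιn PiI hIn hle σ hσ).prop_1_3_iii'_of_branch ?_ ?_ ?_ hsurj hcyc ?_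
  · exact (DPSCData.ofEmbedding G E ι hιr hιn PiI hIn hle).isCommensurablyTerminal_vertSub_of_psc
      (G.mapAlong e.toMulEquiv.toMonoidHom e.continuous G.Sigma subset_rfl G.sigma_nonempty
        (G.proSigma.of_continuousMulEquiv e))
      Equiv.ulift (DPSCData.vertSub_presentation G E ι hιr hιn PiI hIn hle he)
      ((PSCDatum.verticialEdgeLikeCommensurablyTerminal_mapAlong_equiv_iff G e _ _ _ _).mpr hCT)
  · exact (DPSCData.ofEmbedding G E ι hιr hιn PiI hIn hle).isCommensurablyTerminal_cuspSub_of_psc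
      (G.mapAlong e.toMulEquiv.toMonoidHom e.continuous G.Sigma subset_rfl G.sigma_nonempty
        (G.proSigma.of_continuousMulEquiv e))
      Equiv.ulift (DPSCData.cuspSub_presentation G E ι hιr hιn PiI hIn hle he)
      ((PSCDatum.verticialEdgeLikeCommensurablyTerminal_mapAlong_equiv_iff G e _ _ _ _).mpr hCT)
  · exact (DPSCData.ofEmbedding G E ι hιr hιn PiI hIn hle).isSlimGroup_vertSub_of_psc
      (G.mapAlong e.toMulEquiv.toMonoidHom e.continuous G.Sigma subset_rfl G.sigma_nonempty
        (G.proSigma.of_continuousMulEquiv e))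
      Equiv.ulift (DPSCData.vertSub_presentation G E ι hιr hιn PiI hIn hle he) hslim'
  · intro c
    obtain ⟨g, -, hg⟩ := DPSCData.cuspSub_le_conj_vertSub_ofEmbedding G E ι hιr hιn PiI hIn hle c
    exact ⟨g, hg⟩

end Embedding

section OuterAction

variable {P : Type u} [Group P] [TopologicalSpace P] [IsTopologicalGroup P] [CompactSpace P]
  [TotallyDisconnectedSpace P] (G : PSCDatum P) (hG : IsTopologicallyFinitelyGenerated P)
  (hZ : Subgroup.center P = ⊥)
  {J : Type u} [Group J] [TopologicalSpace J] [IsTopologicalGroup J] [CompactSpace J]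
  [TotallyDisconnectedSpace J] (θ : J →ₜ* outProfinite hG) (I : Subgroup J) [I.Normal]
  (σ : G.graph.N → ℕ) (hσ : ∀ e, IsSigmaInteger G.Sigma (σ e))

include hZ

/-- **[AbsTopII] Prop 1.3 (iii) (rest) AS TYPED (F-0299) for `Π_𝒢 ⋊^out_θ J`** from [CombGC] Prop 1.2 (ii)
(F-0438), Rmk 1.1.3 slimness, Dehn-type lifts of `ρ_I` (⇒ "`I_v ↠ I`") and "`I_v ≅ Ẑ^Σ`" — cusp input and
surjectivity input both DISCHARGED. [cite: MochizukiAbsTopII2013, Prop 1.3 (iii) p.11]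
[cite: MochizukiCombGC2007, Prop 1.2 p.8] -/
theorem prop_1_3_iii'_ofOuterAction_of_fixingLifts
    (hCT : G.VerticialEdgeLikeCommensurablyTerminal) (hslimv : ∀ w, IsSlimGroup ↥(G.vertGp w))
    (hDehn : ∀ (v : G.graph.V) (i : J), i ∈ I → ∃ φ : P ≃ₜ* P,
      TopOut.mk P ⟨φ.toMulEquiv, (mem_contMulAut P).mpr ⟨φ.continuous, φ.symm.continuous⟩⟩ =
        outerActionOfContinuous hG θ i ∧ ∀ x ∈ G.vertGp v, φ x = x)
    (hcyc : ∀ v, IsFreeProSigmaCyclic G.Sigma ↥((DPSCData.ofOuterAction G hG θ I).Iv v)) :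
    Literature.AnabelianGeometry.AbsoluteAnabelian.AbsTopII.DPSCIndexData.Prop_1_3_iii'
      (ofOuterAction G hG θ I σ hσ) :=
  prop_1_3_iii'_ofEmbedding G _ _ (inlProfinite hG θ).continuous (inlProfinite_injective hG θ hZ) _ _ _ _ _
    σ hσ hCT hslimv (DPSCData.hsurj_ofOuterAction_of_fixingLifts G hG θ I hDehn) hcyc

end OuterAction

end AbsTopII.DPSCIndexData

end Literature.AnabelianGeometry.AbsoluteAnabelian

end
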